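import Mathlib
import Summits.NavierStokesRegularity.NavierStokesRegularity.Theses.FilamentSkeletonRss
import Literature.Analysis.FluidPDE.GaussianVortexPlanar
import Literature.Analysis.FluidPDE.LerayGaugeStrainSpectrum

/-!
# CoreGluing — crux-ideate round 1, ideator 2: first lemmas of the three idea cards

Crux `stmt-NavierStokesRegularity-15401` =
`Summit.NavierStokesRegularity.NavierStokesRegularity.Theses.FilamentSkeletonRss.CoreGluing`
(`SkeletonEquilibrium → RssProfileExists`). Nothing here is proposed to the tree; every `def … : Prop`
is the FIRST CHECKABLE STATEMENT of a line (cards `zero-accretion-selection`, `skew-cascade-schur`,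
`volterra-ends`), typed over existing declarations so that a crux-plan seat can turn it into a stub.
Two small lemmas are PROVED (the interlacing corollary behind the hyperbolic-core diagnostic, and
the restatement of the crux).
-/

noncomputable section

namespace Summit.NavierStokesRegularity.NavierStokesRegularity.Cruxes.CoreGluing.Sketch

open MeasureTheory Real Set Filter Topology
open scoped InnerProductSpace Laplacian

/-- The crux, by name (sanity: the decl the line must conclude). -/
example : Theses.FilamentSkeletonRss.CoreGluing =
    (Theses.FilamentSkeletonRss.SkeletonEquilibrium → Theses.FilamentSkeletonRss.RssProfileExists) :=
  rfl

/-! ## Card `zero-accretion-selection` — the tube circulation budget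

Along a filament with tangential material speed `w` (one supercritical stagnation point, `Φ' = w`,
`Φ → +∞` at both ends — exactly the structure (SC) of `SkeletonEquilibrium`), the circulation `κ(τ)`
through cross-sectional discs of an EXACT steady profile obeys `κ'' − w κ' = F`, `F` = net sideways
flux of axial vorticity (advective + diffusive) into the exterior. The 1-D rigidity lemma below says a
bounded `κ` forces the `e^{−Φ}`-weighted net flux to vanish; with a signed `F` it forces `F ≡ 0` and
`κ` constant (no steady accretion, no steady stripping). -/

/-- **Accretion budget rigidity (signed form).** If `κ : ℝ → ℝ` is bounded and `C²`, `Φ` is `C¹` with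
`Φ → +∞` at `±∞`, `F ≥ 0` is continuous and `κ'' − Φ' κ' = F` on `ℝ`, then `F ≡ 0` and `κ' ≡ 0`.
(Proof: `ψ := κ' e^{−Φ}` has `ψ' = F e^{−Φ} ≥ 0`; a nonzero limit of `ψ` at `+∞` or `−∞` makes
`κ' ∼ ψ(±∞) e^{Φ}` non-integrable, contradicting boundedness; hence `ψ(±∞) = 0`, `ψ ≡ 0`.) [folklore ODE] -/
def AccretionBudgetRigidity : Prop :=
  ∀ (κ Φ F : ℝ → ℝ), (∃ M : ℝ, ∀ τ, |κ τ| ≤ M) → ContDiff ℝ 2 κ → ContDiff ℝ 1 Φ → Continuous F →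
    Tendsto Φ atTop atTop → Tendsto Φ atBot atTop → (∀ τ, 0 ≤ F τ) →
    (∀ τ, iteratedDeriv 2 κ τ - deriv Φ τ * deriv κ τ = F τ) →
    (∀ τ, F τ = 0) ∧ ∀ τ, deriv κ τ = 0

/-- **Accretion budget rigidity (weighted form, no sign on `F`).** Same hypotheses without `F ≥ 0`:
then the improper integral `∫ F e^{−Φ}` over `ℝ` vanishes — the ZERO-NET-ACCRETION solvability
condition at the stagnation section (the weight `e^{−Φ}` is concentrated where `w = Φ' = 0`). [folklore ODE] -/
def AccretionBudgetZeroMean : Prop :=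
  ∀ (κ Φ F : ℝ → ℝ), (∃ M : ℝ, ∀ τ, |κ τ| ≤ M) → ContDiff ℝ 2 κ → ContDiff ℝ 1 Φ → Continuous F →
    Tendsto Φ atTop atTop → Tendsto Φ atBot atTop →
    Integrable (fun τ => F τ * Real.exp (-Φ τ)) →
    (∀ τ, iteratedDeriv 2 κ τ - deriv Φ τ * deriv κ τ = F τ) →
    ∫ τ, F τ * Real.exp (-Φ τ) = 0

/-- The steady-feed obstruction in its sharpest form (what "a Burgers tube cannot steadily accrete"
means quantitatively): with `Φ = w' τ²/2` (`w(τ) = w' τ`, `w' > 0`) and a feed `F = −Q·𝟙` of total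
weighted size `q = ∫ F e^{−Φ} ≠ 0`, NO bounded `C²` solution exists. Immediate from
`AccretionBudgetZeroMean`. [folklore ODE] -/
theorem no_bounded_solution_of_nonzero_feed (h : AccretionBudgetZeroMean) (κ Φ F : ℝ → ℝ)
    (hb : ∃ M : ℝ, ∀ τ, |κ τ| ≤ M) (hκ : ContDiff ℝ 2 κ) (hΦ : ContDiff ℝ 1 Φ) (hF : Continuous F)
    (h1 : Tendsto Φ atTop atTop) (h2 : Tendsto Φ atBot atTop)
    (hi : Integrable (fun τ => F τ * Real.exp (-Φ τ)))
    (hq : ∫ τ, F τ * Real.exp (-Φ τ) ≠ 0) :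
    ¬ ∀ τ, iteratedDeriv 2 κ τ - deriv Φ τ * deriv κ τ = F τ := fun hODE =>
  hq (h κ Φ F hb hκ hΦ hF h1 h2 hi hODE)

/-! ## Diagnostic shared by the cards — confinement needs the MIDDLE external strain eigenvalue `< −½`

At a stagnation core with unit tangent `t`, the cross-plane rates of `∇W = S_ext + ½·1 + (antisym.)`
are the eigenvalues `μ₁ ≤ μ₂` of the compression of `S_ext + ½` to `t^⊥`; classical (elliptic,
Gallay–Wayne `λ < 1`) Burgers confinement is `μ₂ < 0`. By Courant–Fischer (tree lemma
`strainEigenvalues_mid_le_iff`), `μ₂ < 0` forces the middle principal strain of `∇W` to be `< 0`,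
i.e. `s₂(S_ext) < −½`. The kit scan `kit/c3_strain_scan.py` shows the certified C₃ skew triple has
`μ = (−3.01, +1.11)`: hyperbolic cross-strain, asymmetry `λ ≈ 2.2 > 1`. -/

section Diagnostic

variable {V : Type*} [NormedAddCommGroup V] [InnerProductSpace ℝ V] [FiniteDimensional ℝ V]

/-- **Interlacing corollary.** If the quadratic form of `A` (think `A = ∇W` at the core centre) is
bounded by `a (α² + β²)` on the span of an orthonormal pair `v, w` (think: a basis of `t^⊥`, `a = μ₂`),
then the middle principal strain of `A` is `≤ a`. Hence negative-definite cross-plane rates force a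
negative middle eigenvalue of `sym ∇W = S_ext + ½`. PROVED from the tree's Courant–Fischer lemma. -/
theorem mid_strain_le_of_crossplane_bound (A : V →ₗ[ℝ] V) (h3 : Module.finrank ℝ V = 3)
    {v w : V} (hv : ‖v‖ = 1) (hw : ‖w‖ = 1) (hvw : ⟪v, w⟫_ℝ = 0) {a : ℝ}
    (hle : ∀ α β : ℝ, ⟪A (α • v + β • w), α • v + β • w⟫_ℝ ≤ a * (α ^ 2 + β ^ 2)) :
    Literature.Analysis.FluidPDE.strainEigenvalues A h3 1 ≤ a :=
  (Literature.Analysis.FluidPDE.strainEigenvalues_mid_le_iff A h3 a).2 ⟨v, w, hv, hw, hvw, hle⟩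

/-- Contrapositive used as the **confinement criterion**: if the middle principal strain of `A` is
`> a`, then on EVERY orthonormal two-frame the quadratic form of `A` exceeds `a (α² + β²)` somewhere —
with `a = 0`, `A = ∇W`: some cross direction of every candidate tube orientation expands. PROVED. -/
theorem crossplane_expands_of_mid_strain_gt (A : V →ₗ[ℝ] V) (h3 : Module.finrank ℝ V = 3) {a : ℝ}
    (ha : a < Literature.Analysis.FluidPDE.strainEigenvalues A h3 1)
    {v w : V} (hv : ‖v‖ = 1) (hw : ‖w‖ = 1) (hvw : ⟪v, w⟫_ℝ = 0) :
    ∃ α β : ℝ, a * (α ^ 2 + β ^ 2) < ⟪A (α • v + β • w), α • v + β • w⟫_ℝ := by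
  by_contra hcon
  push Not at hcon
  exact absurd (mid_strain_le_of_crossplane_bound A h3 hv hw hvw hcon) (not_le.2 ha)

end Diagnostic

/-! ## Card `skew-cascade-schur` — uniform-in-circulation core coercivity, and its hyperbolic version

Planar vocabulary of `GaussianVortexPlanar.lean`: `L_λ = strainedVorticityOperator lam`,
`G = gaussVortexProfile`, `v^G = gaussVortexVelocity`, `K_{2D}∗ = biotSavart2D`. The linearised
Euler operator at the Gaussian is `Λ w = v^G·∇w + (K_{2D}∗w)·∇G`. -/

section Planar

open Literature.Analysis.FluidPDE

/-- Local notation for the cross-section plane. -/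
local notation "ℝ²" => EuclideanSpace ℝ (Fin 2)

/-- `Λ w = v^G · ∇w + (K_{2D} ∗ w) · ∇G`, the linearisation at the Lamb–Oseen/Gaussian vortex of the
planar Euler transport term (Gallay–Wayne 2005/2006; Gallay–Maekawa survey (2.10)). -/
def lambdaOp (w : ℝ² → ℝ) (x : ℝ²) : ℝ :=
  ⟪gaussVortexVelocity x, gradient w x⟫_ℝ + ⟪biotSavart2D w x, gradient gaussVortexProfile x⟫_ℝ

/-- **Uniform core coercivity (λ = 0; in print: Gallay–Maekawa survey, display before (4.10):
`⟨(−L + αΛ)f, f⟩_{L²(∞)} ≥ ½‖f‖²` on zero-mass `f`, hence `‖(−L+αΛ)⁻¹‖ ≤ 2` for ALL circulations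
`α`).** Stated as an a-priori inequality for smooth, Gaussian-localised, zero-mass `w`. This is the
`k = 0` (z-independent), radial-plus-skew fibre of the cascade; its proof is `−L ≥ ½` on zero mass
(harmonic-oscillator conjugation) plus skew-adjointness of `Λ` in `L²(G⁻¹ dx)`. [cite: GallayMaekawa2016 survey §4.1] -/
def UniformCoreCoercivity : Prop :=
  ∀ (circ : ℝ) (w : ℝ² → ℝ), ContDiff ℝ 2 w →
    Integrable (fun x => (gaussVortexProfile x)⁻¹ * (w x ^ 2 + ‖gradient w x‖ ^ 2 + (Δ w x) ^ 2
      + ‖x‖ ^ 2 * ‖gradient w x‖ ^ 2)) →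
    ∫ x, w x = 0 →
    (1 / 2 : ℝ) * ∫ x, (gaussVortexProfile x)⁻¹ * w x ^ 2 ≤
      - ∫ x, (gaussVortexProfile x)⁻¹ *
          (strainedVorticityOperator 0 w x - circ * lambdaOp w x) * w x

/-- **Hyperbolic-core coercivity modulo circulation (NEW; the regime of the certified skeleton,
`λ ≈ 2.2 > 1`, outside Maekawa 2009 / Gallay–Maekawa Thm 4.1 which need `λ ∈ [0,1)`).** For every
asymmetry `lam` (no restriction) there are a polynomial weight exponent `m`, a circulation threshold
`κ₀` and a constant `C` such that for all circulations `|circ| ≥ κ₀` every smooth, polynomially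
localised, ZERO-MASS `w` obeys `‖ρ^m w‖_{L²} ≤ C ‖ρ^m (L_lam w − circ·Λ w)‖_{L²}`, `ρ = (1+|x|²)^{1/2}`:
fast rotation restores invertibility transverse to the circulation direction even when one cross
direction expands. Why it might fail: for `lam > 1` the essential spectrum of `L_lam` in `L²(m)`
moves right with the expanding direction and zero-mass is no longer enough (the stripping flux of
card `zero-accretion-selection` is the obstruction to dropping "modulo circulation"). -/
def HyperbolicCoreCoercivityModMass : Prop :=
  ∀ lam : ℝ, ∃ (m κ₀ C : ℝ), 0 < C ∧ ∀ circ : ℝ, κ₀ ≤ |circ| →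
    ∀ w : ℝ² → ℝ, ContDiff ℝ 2 w →
      Integrable (fun x => (1 + ‖x‖ ^ 2) ^ (m + 2) * (w x ^ 2 + ‖gradient w x‖ ^ 2 + (Δ w x) ^ 2)) →
      ∫ x, w x = 0 →
      ∫ x, (1 + ‖x‖ ^ 2) ^ m * w x ^ 2 ≤
        C ^ 2 * ∫ x, (1 + ‖x‖ ^ 2) ^ m * (strainedVorticityOperator lam w x - circ * lambdaOp w x) ^ 2

end Planar

/-- **Swept-resonance bound (the `k`-transport fibre of the cascade; 1-D model).** Gallay–Maekawa's
identity `[∂₃, L] = −∂₃` makes the axial wavenumber `k` a TRANSPORTED variable: the steady linearised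
problem along `k` is `γ k φ'(k) + (a(k) + i Γ ω(k)) φ(k) = f(k)` with damping `Re a ≥ a₀ > 0` and an
arbitrarily large real detuning `Γ ω(k)` (Kelvin branch). At an interior maximum of `‖φ‖` the
oscillatory term drops out of the real part: `a₀ ‖φ‖ ≤ ‖f‖` there — uniformly in `Γ` and `ω`.
("Oscillation never hurts a transport resolvent"; zero-frequency Kelvin crossings `k_c` are swept,
not resonant.) [folklore ODE] -/
def SweptResonanceBound : Prop :=
  ∀ (γ Γ a₀ : ℝ) (a ω : ℝ → ℝ) (φ f : ℝ → ℂ) (k₀ : ℝ), 0 < a₀ → Differentiable ℝ φ →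
    (∀ k, a₀ ≤ a k) →
    (∀ k : ℝ, ((γ * k : ℝ) : ℂ) * deriv φ k + (((a k : ℝ) : ℂ) + ((Γ * ω k : ℝ) : ℂ) * Complex.I) * φ k = f k) →
    IsMaxOn (fun k => ‖φ k‖) Set.univ k₀ →
    a₀ * ‖φ k₀‖ ≤ ‖f k₀‖

/-! ## Card `volterra-ends` — outgoing (Volterra) structure of the far field / filament ends -/

/-- **Outgoing envelope propagation (1-D model of `½(1 + r∂ᵣ)` transport with nonnegative extra
damping `a ≥ 0` along a ray or a filament end).** If `r φ'(r) + (1 + a(r)) φ(r) = g(r)` on `[R, ∞)`,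
`R > 0`, then `|r φ(r)| ≤ |R φ(R)| + ∫_R^r |g|` for all `r ≥ R`: the Type-I envelope `r|φ|` is
controlled by its value at the matching radius plus the integrated source — no solvability
condition at infinity (triangular/Volterra structure). Integrating factor `exp(∫ a/s)`. [folklore ODE] -/
def OutgoingEnvelopeBound : Prop :=
  ∀ (R : ℝ) (φ a g : ℝ → ℝ), 0 < R → DifferentiableOn ℝ φ (Set.Ici R) → ContinuousOn a (Set.Ici R) →
    ContinuousOn g (Set.Ici R) → (∀ r, R ≤ r → 0 ≤ a r) →
    (∀ r, R < r → r * deriv φ r + (1 + a r) * φ r = g r) →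
    ∀ r, R ≤ r → |r * φ r| ≤ |R * φ R| + ∫ s in R..r, |g s|

/-- **The inviscid end operator is NOT Volterra (why CoreGluing must not be built on an exact
inviscid skeleton):** the local-induction end equation `i c ζ'' − w ζ' = 0` with `c ≠ 0` has, besides
constants, the bounded oscillatory solution `ζ' = exp(−(i/c) ∫ w)` — a neutral helical Kelvin wave of
growing local wavenumber `w/c` along the end. Stated: for `c ≠ 0` and continuous `w` there is a
non-constant `ζ` with `‖deriv ζ‖ ≡ 1` solving the equation. (Viscosity damps it at the profile level
once `(w/c)·r_core ≳ 1`; that damping is the content of the card's first stub.) [folklore ODE] -/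
def InviscidEndHasNeutralMode : Prop :=
  ∀ (c : ℝ) (w : ℝ → ℝ), c ≠ 0 → Continuous w →
    ∃ ζ : ℝ → ℂ, Differentiable ℝ ζ ∧ Differentiable ℝ (deriv ζ) ∧ (∀ τ, ‖deriv ζ τ‖ = 1) ∧
      ∀ τ, (c : ℂ) * Complex.I * deriv (deriv ζ) τ - (w τ : ℂ) * deriv ζ τ = 0

/-- The neutral mode, explicitly: `ζ(τ) = ∫₀^τ exp(−(i/c) W)`, `W = ∫₀ w`. PROVED that its
derivative has unit modulus (the differential equation itself is left to the stub). -/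
theorem norm_exp_neg_I_mul (c : ℝ) (W : ℝ) :
    ‖Complex.exp (-((W / c : ℝ) : ℂ) * Complex.I)‖ = 1 := by
  rw [Complex.norm_exp]
  simp [Complex.mul_re, Complex.neg_re, Complex.ofReal_re, Complex.ofReal_im, Complex.I_re,
    Complex.I_im]

end Summit.NavierStokesRegularity.NavierStokesRegularity.Cruxes.CoreGluing.Sketch
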